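import Mathlib
import Summits.Ventures.PercRepro2.HCov
import Summits.Ventures.PercRepro2.RootLeafUMixK
import Summits.Ventures.PercRepro2.RootLeafUCoin3Outside

/-!
# (G4-u): the (MIX-K) threshold dominates the conditional `b`-share on EVERY instance
(blind cell PercRepro2, p4 g17; S3 (G4-u) item (ad), proofs/P4-G17-COIN3.md §9)

With `A = α + κ`, `β = S·D + d0·Z` the constants of RootLeafUHalf, `P₀ = D + t′ = P(Q, c ∉ K)` and
`pbK = P(PD, bK) + P(T′, bK) = P(Q, c ∉ K, bK)`:

  `A·P₀ − 2β·pbK = 2·[ P₀(hb·P₀ − pbK) + P(PD,bL)(P₀ − d0·Z) + (t′·P(PD,bK) − D·P(T′,bK))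
                     + d0·(P₀·P(T,bK) − t·pbK) + d0·((P(PD,bL) + P(T′,bL))·t − P₀·P(T,bL)) + P(T′,bL)(P₀ − d0·Z) ]`

— an exact identity after `Qsplit` and `gap_eq_Q`, and every bracket is a standard fact: Harris
(`pbK ≤ hb·P₀`; `d0·Z ≤ P₀`, twice), BHK06 1.4 in the `K`-avoids-`{u, c}` world (`MixK.HoK_nonneg`
at `o := b`), BHK06 1.3 on `Q` (`b ∈ K`, `c ∈ K` positively correlated), BHK06 1.4 on `Q`
(`b ∈ L` against `c ∈ K`).  Hence **`2β·pbK ≤ A·P₀`** (`A_mul_P0_ge`): `λ = A/(2β) ≥ P(bK | Q, c ∉ K)`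
on every instance — the general form of the coin class's `Λ ≥ 0` (RootLeafUShareK) and of
`M_K ≥ 0` at `k = 0` (RootLeafUCoin3AlgK).
-/

namespace Summit.Ventures.PercRepro2

open UnionCluster CovForm

namespace RootLeafU

namespace Threshold

variable {V : Type*} {E : Type*} [Fintype E] [DecidableEq E] [Fintype V] [DecidableEq V]
  {R : Type*} [Field R] [LinearOrder R] [IsStrictOrderedRing R]

variable (p : E → R) (ends : E → Sym2 V) (a₂ c b u : V)

omit [Fintype E] [DecidableEq E] [Fintype V] [DecidableEq V] [LinearOrder R] [IsStrictOrderedRing R] in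
/-- `connEvent` is symmetric. -/
lemma connEvent_comm (x y : V) : connEvent ends x y = connEvent ends y x := by
  ext ω
  exact ⟨conn_symm, conn_symm⟩

omit [Fintype V] in
/-- Harris: `P(Q, c ∉ K, bK) ≤ hb · P(Q, c ∉ K)`. -/
lemma pbK_le (hp : IsProbVec p) :
    prob p (PDEvent ends u a₂ c ∩ connEvent ends a₂ b) + prob p (TEvent ends a₂ u c ∩ connEvent ends a₂ b) ≤
      prob p (connEvent ends a₂ b) * (prob p (PDEvent ends u a₂ c) + prob p (TEvent ends a₂ u c)) := by
  have h := prob_inter_le_prob_mul_prob_of_isLowerSet hp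
    (A := avoidAll ends a₂ {u} ∩ (connEvent ends a₂ c)ᶜ) (B := connEvent ends a₂ b)
    (by
      rw [Coin3.avoidAll_singleton_eq_compl]
      exact (isUpperSet_connEvent ends a₂ u).compl.inter (isUpperSet_connEvent ends a₂ c).compl)
    (isUpperSet_connEvent ends a₂ b)
  rw [Coin3.out_P00oK p ends b u a₂ c, Coin3.out_P00 p ends u a₂ c] at h
  linarith

omit [Fintype V] in
/-- Harris: `d0 · Z ≤ P(Q, c ∉ K)`. -/
lemma d0_mul_Z_le (hp : IsProbVec p) :
    prob p (avoidAll ends a₂ {c}) * prob p (avoidAll ends a₂ {u}) ≤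
      prob p (PDEvent ends u a₂ c) + prob p (TEvent ends a₂ u c) := by
  have h := prob_mul_prob_le_prob_inter_of_isLowerSet hp
    (A := avoidAll ends a₂ {u}) (B := (connEvent ends a₂ c)ᶜ)
    (by rw [Coin3.avoidAll_singleton_eq_compl]; exact (isUpperSet_connEvent ends a₂ u).compl)
    (isUpperSet_connEvent ends a₂ c).compl
  rw [Coin3.out_P00 p ends u a₂ c, ← Coin3.avoidAll_singleton_eq_compl] at h
  linarith

/-- BHK06 1.3 on `Q`: `pbK · t ≤ P(T, bK) · P₀`. -/
lemma pbK_mul_t_le (hp : IsProbVec p) :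
    (prob p (PDEvent ends u a₂ c ∩ connEvent ends a₂ b) + prob p (TEvent ends a₂ u c ∩ connEvent ends a₂ b)) *
        prob p (TEvent ends u a₂ c) ≤
      prob p (TEvent ends u a₂ c ∩ connEvent ends a₂ b) *
        (prob p (PDEvent ends u a₂ c) + prob p (TEvent ends a₂ u c)) := by
  have h := bhk_same_cluster_events p hp ends a₂ u (isUpperSet_mem_setOf b) (isUpperSet_mem_setOf c)
  rw [← connEvent_eq_clusterInEvent ends a₂ b, ← connEvent_eq_clusterInEvent ends a₂ c,
    ← Coin3.avoidAll_singleton_eq_compl] at h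
  have e1 : connEvent ends a₂ b ∩ avoidAll ends a₂ {u} = avoidAll ends a₂ {u} ∩ connEvent ends a₂ b :=
    Set.inter_comm _ _
  have e2 : connEvent ends a₂ c ∩ avoidAll ends a₂ {u} = TEvent ends u a₂ c := by
    rw [Coin3.avoidAll_singleton_eq_compl]; exact Set.inter_comm _ _
  have e3 : connEvent ends a₂ b ∩ connEvent ends a₂ c ∩ avoidAll ends a₂ {u} =
      TEvent ends u a₂ c ∩ connEvent ends a₂ b := by
    rw [Coin3.avoidAll_singleton_eq_compl]
    ext ω
    simp only [Set.mem_inter_iff, Set.mem_compl_iff, mem_connEvent, TEvent]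
    tauto
  rw [e1, e2, e3, Qsplit p ends u a₂ c (connEvent ends a₂ b), Qsplit_univ p ends u a₂ c] at h
  nlinarith [h]

/-- BHK06 1.4 on `Q`: `P(T, bL) · P₀ ≤ (P(PD, bL) + P(T′, bL)) · t`. -/
lemma TbL_mul_P0_le (hp : IsProbVec p) :
    prob p (TEvent ends u a₂ c ∩ connEvent ends u b) *
        (prob p (PDEvent ends u a₂ c) + prob p (TEvent ends a₂ u c)) ≤
      (prob p (PDEvent ends u a₂ c ∩ connEvent ends u b) + prob p (TEvent ends a₂ u c ∩ connEvent ends u b)) *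
        prob p (TEvent ends u a₂ c) := by
  have h := bhk_cross_cluster p hp ends u a₂ (isUpperSet_mem_setOf b) (isUpperSet_mem_setOf c)
  rw [← connEvent_eq_clusterInEvent ends u b, ← connEvent_eq_clusterInEvent ends a₂ c,
    connEvent_comm ends u a₂, ← Coin3.avoidAll_singleton_eq_compl] at h
  have e1 : connEvent ends u b ∩ avoidAll ends a₂ {u} = avoidAll ends a₂ {u} ∩ connEvent ends u b :=
    Set.inter_comm _ _
  have e2 : connEvent ends a₂ c ∩ avoidAll ends a₂ {u} = TEvent ends u a₂ c := by
    rw [Coin3.avoidAll_singleton_eq_compl]; exact Set.inter_comm _ _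
  have e3 : connEvent ends u b ∩ connEvent ends a₂ c ∩ avoidAll ends a₂ {u} =
      TEvent ends u a₂ c ∩ connEvent ends u b := by
    rw [Coin3.avoidAll_singleton_eq_compl]
    ext ω
    simp only [Set.mem_inter_iff, Set.mem_compl_iff, mem_connEvent, TEvent]
    tauto
  rw [e1, e2, e3, Qsplit p ends u a₂ c (connEvent ends u b), Qsplit_univ p ends u a₂ c] at h
  nlinarith [h]

/-- **The threshold dominates the share**: `2β · P(Q, c ∉ K, bK) ≤ A · P(Q, c ∉ K)` on every instance
(`A`, `β` as in RootLeafUHalf / MixK, `S = P(Ω)`). -/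
theorem A_mul_P0_ge (hp : IsProbVec p) :
    2 * (prob p Set.univ * prob p (PDEvent ends u a₂ c) + prob p (avoidAll ends a₂ {c}) * prob p (avoidAll ends a₂ {u})) *
        (prob p (PDEvent ends u a₂ c ∩ connEvent ends a₂ b) + prob p (TEvent ends a₂ u c ∩ connEvent ends a₂ b)) ≤
      ((prob p (PDEvent ends u a₂ c) * prob p (connEvent ends a₂ b) + prob p (avoidAll ends a₂ {c}) * gap p ends u a₂ b) +
          (prob p Set.univ * EQb3 p ends u a₂ c b + prob p Set.univ * PDb p ends u a₂ c b +
            prob p (connEvent ends a₂ b) * EQ3 p ends u a₂ c + prob p (connEvent ends a₂ b) * prob p (avoidAll ends a₂ {u}) -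
            (prob p Set.univ - prob p (avoidAll ends a₂ {c})) * gap p ends u a₂ b)) *
        (prob p (PDEvent ends u a₂ c) + prob p (TEvent ends a₂ u c)) := by
  have h1 := pbK_le p ends a₂ c b u hp
  have h2 := d0_mul_Z_le p ends a₂ c u hp
  rw [Qsplit_univ p ends u a₂ c] at h2
  have h3 := MixK.HoK_nonneg p ends b a₂ c u hp
  have h4 := pbK_mul_t_le p ends a₂ c b u hp
  have h5 := TbL_mul_P0_le p ends a₂ c b u hp
  have hP0 : 0 ≤ prob p (PDEvent ends u a₂ c) + prob p (TEvent ends a₂ u c) :=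
    add_nonneg (prob_nonneg hp _) (prob_nonneg hp _)
  have hPDbL : 0 ≤ prob p (PDEvent ends u a₂ c ∩ connEvent ends u b) := prob_nonneg hp _
  have hTpbL : 0 ≤ prob p (TEvent ends a₂ u c ∩ connEvent ends u b) := prob_nonneg hp _
  have hd0 : 0 ≤ prob p (avoidAll ends a₂ {c}) := prob_nonneg hp _
  have t1 := mul_nonneg hP0 (sub_nonneg.mpr h1)
  have t2 := mul_nonneg hPDbL (sub_nonneg.mpr h2)
  have t4 := mul_nonneg hd0 (sub_nonneg.mpr h4)
  have t5 := mul_nonneg hd0 (sub_nonneg.mpr h5)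
  have t6 := mul_nonneg hTpbL (sub_nonneg.mpr h2)
  unfold EQb3 PDb EQ3
  rw [prob_univ, gap_eq_Q p ends u a₂ b, Qsplit p ends u a₂ c (connEvent ends a₂ b),
    Qsplit p ends u a₂ c (connEvent ends u b), Qsplit_univ p ends u a₂ c]
  nlinarith [t1, t2, h3, t4, t5, t6]

end Threshold

end RootLeafU

end Summit.Ventures.PercRepro2
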